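import Summits.AnomalousDissipation.AnomalousDissipation.Theorems.ImpulseGridBoundedEnergyNoLeakGridHardnessLH
import HarnessLib

/-!
# `¬ ImpulseGrid.BoundedEnergyNoLeakGrid` modulo `Correlation.EnergyUnboundedNegZM`
# (crux stmt-AnomalousDissipation-14350; negative-modulo link to stmt-AnomalousDissipation-14642)

Negative-side support file for the crux `Summit.AnomalousDissipation.AnomalousDissipation.Theses.ImpulseGrid.BoundedEnergyNoLeakGrid`
(item stmt-AnomalousDissipation-14350).  Correlation's negative rung `EnergyUnboundedNegZM` (stmt-14642: for EVERY
non-zero smooth steady force and EVERY zero-momentum vanishing-viscosity global Leray–Hopf family the limsup-mean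
energies are unbounded) refutes the crux, because the crux implies `Correlation.BoundedEnergyFamilyZM`
(`boundedEnergyFamilyZM_of_boundedEnergyNoLeakGrid`, Galilean covariance of Leray–Hopf solutions).  `H =
EnergyUnboundedNegZM` is itself an open (and, by DNS of gravest-mode 3-D Kolmogorov flow, probably false) statement,
so this is a LINK between ledger items, not a refutation of the crux.
-/

-- `Summit.<Summit>.<Problem>` is the tree's mandated summit-side namespace (CONVENTIONS §2); for this
-- single-conjunct summit the two coincide, so the duplicate is deliberate.
set_option linter.dupNamespace false

namespace Summit.AnomalousDissipation.AnomalousDissipation.Theorems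

/-- **`Correlation.EnergyUnboundedNegZM → ¬ ImpulseGrid.BoundedEnergyNoLeakGrid`**: the crux yields a non-zero smooth
steady force with a zero-momentum bounded-energy vanishing-viscosity global Leray–Hopf family
(`boundedEnergyFamilyZM_of_boundedEnergyNoLeakGrid`), which `EnergyUnboundedNegZM` forbids. [folklore] -/
theorem BoundedEnergyNoLeakGrid_false_of_EnergyUnboundedNegZM :
    Summit.AnomalousDissipation.AnomalousDissipation.Theses.Correlation.EnergyUnboundedNegZM → ¬ Summit.AnomalousDissipation.AnomalousDissipation.Theses.ImpulseGrid.BoundedEnergyNoLeakGrid := by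
  intro hNeg hX
  obtain ⟨f, hfs, hfdiv, hfmean, hfne, ν, u₀, u, hν, hν0, hzm, hLH, hE⟩ :=
    boundedEnergyFamilyZM_of_boundedEnergyNoLeakGrid hX
  exact hNeg f hfs hfdiv hfmean hfne ν u₀ u hν hν0 hzm hLH hE

end Summit.AnomalousDissipation.AnomalousDissipation.Theorems
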